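import Literature.NumberTheory.EllipticCurves.HeegnerPointsKolyvaginEulerSystem
import Mathlib.Tactic.Ring
import HarnessLib

/-!
# The COUPLED Cassels–Tate telescope at level `p^M`, I: preliminaries and ONE STEP of McCallum's chain
# across the two curves (abstract; `𝒪`-spans through an operator `w`; any prime `p`)

Helper toward crux `UpperOffV0HSYPlus` (stmt-BirchSwinnertonDyer-19804) of route
`SylvesterTwoHeegnerIndex` (rung K7t, leaf `X12.CMAtTwo`), skeleton of record VARIANT M
`Cruxes/UpperOffV0HSYPlus/Lines/coupled_variantM.lean` (406ca288e244d392), OPEN stubs `stub_tailFour` /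
`stub_tailSeven` (row k-p2) = the TAILS «`s_B + s_A ≤ ord₂(#Ш_an(B)·#Ш_an(A))` on the pairs with
`4 < #Ш(B)[2^∞]·#Ш(A)[2^∞]`», i.e. THEOREM K3 / K3* of MEMO-bsd-cm-two §64–§65 (the coupled McCallum
§5 for the Hu–Shu–Yin pair `(A, B) = (E_{3p²}, E_p)` over `K = ℚ(ω)` at the inert prime `2`).

CONTEXT.  The tree proves Kolyvagin's ORDER bound for `p` odd, one curve, `τ`-eigenspaces
(`Literature/…/HeegnerPointsKolyvaginPrimaryOrderTelescopeProofs.lean`: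
`KolyvaginDescent.HypothesesM.exists_chain_of_casselsTate` / `sum_expo_le_M₀_of_casselsTate`) by running
McCallum's induction (Thm. 5.4) with the invariant
**(I)** *`p^i c(n_k) ∈ ⟨s_j : j > k⟩ ⟹ i ≥ (M − M₀) + N₁ + ⋯ + N_k`*
instead of the optimality `p^{M_k} ∥ P_{n_k}` — so that Prop. 5.2 (the prime-replacement step, whose
auxiliary class of exact order is memo two's flag (h7), §64.4/§65) is never used for `∑ Nᵢ ≤ M₀`.
This file and its sequel `…CoupledTelescope.lean` transpose that TELESCOPE to the coupled dictionary
of memo §57/§64 («`ε(−1)^r`-eigenspace ↦ curve `X_r`», `X_r = B` for `r` even, `A` for `r` odd;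
«cyclic of order `p^N`» ↦ «`𝒪/2^N`», `𝒪 = ℤ[ω]` acting through an additive operator `w`, `𝒪`-spans
written `closure (T ∪ w '' T)`).

THIS FILE: §0 preliminaries (exact `p`-power orders; `𝒪`-combinations in `closure (T ∪ w '' T)`;
`𝒪`-independence as flag conditions; isotropy along an `𝒪`-span — the `𝒪`-forms of the odd-`p`
telescope's `private` helpers, which are the case `w = 0`; the square-free bookkeeping is REUSED from the
tree by the sequel: `KolyvaginDescent.KolSupp`, `kolSupp_one`, `kolSupp_mul_of_prime_not_dvd`,
`SplitDataM.card_primeFactors_mul_of_not_dvd` — planner D558 (K1-a)) and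
§1 `coupledStep` = ONE step `k → k+1` of McCallum's chain ((21)–(23) + the Cassels–Tate contradiction),
generic in the pair (current group `V` ∋ `c_{χ_k,M}(n_k)`, next group `V'` ∋ `c_{χ_{k+1},M}(ℓn_k)`,
`s_{k+1}`, pairing `P'`), so that both parities of the coupled chain are the same lemma.  Displayed
leaves of the step: the FLIP with multiples at the new prime (McCallum Prop. 4.4 ↦ memo (P2):
`p^a c_next(ℓ)_λ Selmer ↔ p^a c_cur ∈ A ℓ`), the Cassels–Tate value clause `hCTV` on the next curve
(Prop. 4.7 + Lemma 5.3 ↦ memo (P5) + (P6), sesquilinear `(( , ))`), and the mixed Čebotarev clause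
`hCeb` (memo COROLLARY 3.2″, kernel form) for the two `𝒪`-spans `𝒪·⟨c_cur, T_c⟩ ⊂ V`,
`𝒪·⟨s, T_n⟩ ⊂ V'`.
Theorem-only (no definition, no named fact, no structure); nothing asserted on 19804; no stub closed;
no label moves; BSD not claimed for any curve.  Sources: McCallum 1991 (LMS LN 153) §3 Prop. 3.1,
§4 Prop. 4.4/4.7, §5 Lemma 5.3, Thm. 5.4 (proof (21)–(23)); MEMO-bsd-cm-two §57.3, §59.1, §64.0–64.5;
line card `Cruxes/UpperOffV0HSYPlus/Lines/cmframe-kolyvagin2.md` v35.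
-/

-- every Summits module is named `Summit.<Summit>.<Problem>…`: the duplicated component is by design
set_option linter.dupNamespace false
set_option autoImplicit false

open scoped Classical

namespace Summit.BirchSwinnertonDyer.BirchSwinnertonDyer.Theorems.SylvesterTwoCoupledTelescope

open Literature.NumberTheory.EllipticCurves Literature.NumberTheory.EllipticCurves.KolyvaginDescent

/-! ## §0. Preliminaries: `p`-power orders, `𝒪`-combinations, flags, isotropy along a span -/

section Prelim

variable {V : Type*} [AddCommGroup V]

/-- Exact order `p^N` (`p^N s = 0`, `p^{N-1} s ≠ 0`) gives `p^a s ≠ 0` for every `a < N`. [folklore] -/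
theorem pow_zsmul_ne_zero_of_lt {p : ℕ} {s : V} {N a : ℕ}
    (hN' : N ≠ 0 → ((p : ℤ) ^ (N - 1)) • s ≠ 0) (ha : a < N) : ((p : ℤ) ^ a) • s ≠ 0 := by
  intro h
  refine hN' (by omega) ?_
  rw [show N - 1 = (N - 1 - a) + a by omega, pow_add, ← smul_smul, h, smul_zero]

/-- `p^a x = 0` and `p^{M-1} x ≠ 0` force `M ≤ a`. [folklore] -/
theorem le_of_pow_zsmul_eq_zero {p : ℕ} {x : V} {M a : ℕ} (hx : ((p : ℤ) ^ (M - 1)) • x ≠ 0)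
    (h : ((p : ℤ) ^ a) • x = 0) : M ≤ a := by
  by_contra hlt
  refine hx ?_
  rw [show M - 1 = (M - 1 - a) + a by omega, pow_add, ← smul_smul, h, smul_zero]

/-- A prime beyond `n ≠ 0` does not divide it. [folklore] -/
theorem not_dvd_of_lt {ℓ n : ℕ} (hn0 : n ≠ 0) (hlt : n < ℓ) : ¬ ℓ ∣ n := fun h ↦ by
  have := Nat.le_of_dvd (Nat.pos_of_ne_zero hn0) h
  omega

/-- An element of the `𝒪`-span `closure (T ∪ w '' T)` of a finite family `T = {s j : j ∈ J}` is an
`𝒪`-combination `∑ (α_j s_j + β_j w s_j)`. [folklore] -/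
theorem exists_sum_of_mem_closure (w : V →+ V) (s : ℕ → V) (J : Finset ℕ) {v : V}
    (hv : v ∈ AddSubgroup.closure (((J.image s : Finset V) : Set V) ∪ w '' ((J.image s : Finset V) : Set V))) :
    ∃ α β : ℕ → ℤ, v = ∑ j ∈ J, (α j • s j + β j • w (s j)) := by
  induction hv using AddSubgroup.closure_induction with
  | mem u hu =>
    rw [Finset.coe_image, Set.mem_union, Set.mem_image] at hu
    rcases hu with ⟨j, hj, rfl⟩ | ⟨u', hu', rfl⟩
    · rw [Finset.mem_coe] at hj
      refine ⟨fun i ↦ if i = j then 1 else 0, 0, ?_⟩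
      simp only [ite_smul, one_smul, zero_smul, Pi.zero_apply, add_zero, Finset.sum_ite_eq', hj,
        if_true]
    · rw [Set.mem_image] at hu'
      obtain ⟨j, hj, rfl⟩ := hu'
      rw [Finset.mem_coe] at hj
      refine ⟨0, fun i ↦ if i = j then 1 else 0, ?_⟩
      simp only [ite_smul, one_smul, zero_smul, Pi.zero_apply, zero_add, Finset.sum_ite_eq', hj,
        if_true]
  | zero => exact ⟨0, 0, by simp⟩
  | add u u' _ _ hu hu' =>
    obtain ⟨α, β, rfl⟩ := hu
    obtain ⟨α', β', rfl⟩ := hu'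
    refine ⟨α + α', β + β', ?_⟩
    simp only [Pi.add_apply, add_smul, ← Finset.sum_add_distrib]
    refine Finset.sum_congr rfl fun j _ ↦ ?_
    abel
  | neg u _ hu =>
    obtain ⟨α, β, rfl⟩ := hu
    refine ⟨-α, -β, ?_⟩
    simp only [Pi.neg_apply, neg_smul, ← Finset.sum_neg_distrib, neg_add]

/-- `𝒪`-independence as a flag condition: if `x, {s_j : j ∈ I}` are `𝒪`-independent
(`(b + c w)x + ∑ (α_j + β_j w)s_j = 0 ⟹` every term vanishes) then `a x ∈ 𝒪·⟨s_j : j ∈ J⟩`, `J ⊆ I`,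
forces `a x = 0`. [folklore] -/
theorem zsmul_eq_zero_of_mem_closure_of_indep (w : V →+ V) (s : ℕ → V) (I : Finset ℕ) (x : V)
    (hind : ∀ (b c : ℤ) (α β : ℕ → ℤ),
      (b • x + c • w x) + ∑ j ∈ I, (α j • s j + β j • w (s j)) = 0 →
        b • x + c • w x = 0 ∧ ∀ j ∈ I, α j • s j + β j • w (s j) = 0)
    {J : Finset ℕ} (hJ : J ⊆ I) {a : ℤ}
    (h : a • x ∈ AddSubgroup.closure
      (((J.image s : Finset V) : Set V) ∪ w '' ((J.image s : Finset V) : Set V))) :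
    a • x = 0 := by
  obtain ⟨α, β, hαβ⟩ := exists_sum_of_mem_closure w s J h
  have hsub : I ∩ J = J := Finset.inter_eq_right.mpr hJ
  have hrel : (a • x + (0 : ℤ) • w x) +
      ∑ j ∈ I, ((if j ∈ J then -α j else 0) • s j + (if j ∈ J then -β j else 0) • w (s j)) = 0 := by
    have h1 : ∀ j, ((if j ∈ J then -α j else 0) • s j + (if j ∈ J then -β j else 0) • w (s j)) =
        if j ∈ J then -(α j • s j + β j • w (s j)) else 0 := by
      intro j
      by_cases h : j ∈ J
      · simp only [h, if_true, neg_smul, neg_add]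
      · simp only [h, if_false, zero_smul, add_zero]
    simp only [zero_smul, add_zero, h1, Finset.sum_ite_mem, hsub, Finset.sum_neg_distrib, ← hαβ,
      add_neg_cancel]
  simpa using (hind a 0 _ _ hrel).1

/-- The same flag condition for a member `s_k` of the family against the later members
(`a s_k ∈ 𝒪·⟨s_j : j ∈ J⟩`, `k ∉ J ⊆ I ∋ k` `⟹ a s_k = 0`). [folklore] -/
theorem zsmul_eq_zero_of_mem_closure_of_indep' (w : V →+ V) (s : ℕ → V) (I : Finset ℕ)
    (hind : ∀ (α β : ℕ → ℤ), ∑ j ∈ I, (α j • s j + β j • w (s j)) = 0 →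
      ∀ j ∈ I, α j • s j + β j • w (s j) = 0)
    {k : ℕ} (hk : k ∈ I) {J : Finset ℕ} (hJ : J ⊆ I) (hkJ : k ∉ J) {a : ℤ}
    (h : a • s k ∈ AddSubgroup.closure
      (((J.image s : Finset V) : Set V) ∪ w '' ((J.image s : Finset V) : Set V))) :
    a • s k = 0 := by
  obtain ⟨α, β, hαβ⟩ := exists_sum_of_mem_closure w s J h
  have hsub : I ∩ J = J := Finset.inter_eq_right.mpr hJ
  set α' : ℕ → ℤ := fun j ↦ (if j = k then a else 0) + (if j ∈ J then -α j else 0) with hα'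
  set β' : ℕ → ℤ := fun j ↦ if j ∈ J then -β j else 0 with hβ'
  have hrel : ∑ j ∈ I, (α' j • s j + β' j • w (s j)) = 0 := by
    have h1 : ∀ j, (α' j • s j + β' j • w (s j)) =
        (if j = k then a • s j else 0) + (if j ∈ J then -(α j • s j + β j • w (s j)) else 0) := by
      intro j
      simp only [hα', hβ']
      split_ifs <;> simp [neg_smul, add_smul] <;> abel
    simp only [h1, Finset.sum_add_distrib, Finset.sum_ite_eq', hk, if_true, Finset.sum_ite_mem, hsub,
      Finset.sum_neg_distrib, ← hαβ, add_neg_cancel]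
  have := hind α' β' hrel k hk
  simpa [hα', hβ', hkJ] using this

/-- Isotropy along an `𝒪`-span: if `t ∈ Sel` pairs to zero with every generator of `S ⊆ Sel`, it pairs to
zero with every Selmer element of `closure S`. [folklore] -/
theorem pairing_eq_zero_of_mem_closure {Sel : AddSubgroup V} {R : Type*} [AddCommGroup R]
    (P : Sel →+ Sel →+ R) {S : Set V} (hS : S ⊆ Sel) {t : V} (ht : t ∈ Sel)
    (h0 : ∀ u, ∀ hu : u ∈ S, P ⟨u, hS hu⟩ ⟨t, ht⟩ = 0)
    {g : V} (hg : g ∈ AddSubgroup.closure S) (hgS : g ∈ Sel) :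
    P ⟨g, hgS⟩ ⟨t, ht⟩ = 0 := by
  have hle : AddSubgroup.closure S ≤ Sel := (AddSubgroup.closure_le _).mpr hS
  revert hgS
  induction hg using AddSubgroup.closure_induction with
  | mem u h => exact fun _ ↦ h0 u h
  | zero => exact fun h ↦ by rw [show (⟨0, h⟩ : Sel) = 0 from rfl, map_zero, AddMonoidHom.zero_apply]
  | add u u' hu hu' ih ih' =>
    intro h
    have : (⟨u + u', h⟩ : Sel) = ⟨u, hle hu⟩ + ⟨u', hle hu'⟩ := rfl
    rw [this, map_add, AddMonoidHom.add_apply, ih (hle hu), ih' (hle hu'), add_zero]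
  | neg u hu ih =>
    intro h
    rw [show (⟨-u, h⟩ : Sel) = -⟨u, hle hu⟩ from rfl, map_neg, AddMonoidHom.neg_apply, ih (hle hu),
      neg_zero]

/-- The `𝒪`-span of a subset of a `w`-stable subgroup `Sel` lies in `Sel`. [folklore] -/
theorem closure_union_image_le {Sel : AddSubgroup V} (w : V →+ V) (hw : ∀ s ∈ Sel, w s ∈ Sel)
    {S : Set V} (hS : S ⊆ Sel) : AddSubgroup.closure (S ∪ w '' S) ≤ Sel := by
  refine (AddSubgroup.closure_le _).mpr (Set.union_subset hS ?_)
  rintro _ ⟨u, hu, rfl⟩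
  exact hw u (hS hu)

end Prelim

/-! ## §1. One step of the coupled chain (McCallum Thm. 5.4, (21)–(23), across the two curves) -/

section Step

variable {V V' : Type*} [AddCommGroup V] [AddCommGroup V'] {Pl : Type*} {R : Type*} [AddCommGroup R]

/-- **One step `k → k+1` of the coupled Cassels–Tate telescope** (McCallum 1991, proof of Thm. 5.4,
(21)–(23), in the coupled dictionary of memo two §64.5).  `V` is the ambient group of the CURRENT curve
`X_k` (where `c_cur = c_{χ_k,M}(n_k)` lives), `V'` that of the NEXT curve `X_{k+1}` (where the new class
`c_next ℓ = c_{χ_{k+1},M}(ℓ n_k)`, the next lift `s = s_{k+1}` and the Cassels–Tate pairing `P'` live);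
`T_c ⊆ V`, `T_n ⊆ V'` are the pools of LATER lifts on the two curves.  GIVEN: the FLIP with multiples at
the new prime (`p^a c_next(ℓ)_λ = 0 in H¹(K_λ, X_{k+1}) ↔ p^a c_cur ∈ A ℓ`), the Cassels–Tate value
clause `hCTV` on `X_{k+1}`, the mixed Čebotarev clause `hCeb` for (`c_cur`, `T_c`) and (`s`, `T_n`), the
exact order `p^{N}` of `s` with room `N + M₀ ≤ M`, `s ∈ A' q` at the primes of `n`, isotropy of `s`
against the `𝒪`-span of `T_n`, the flag condition for `s`, and the invariant (I) «`p^i c_cur ∈ 𝒪·⟨T_c⟩ ⟹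
B₀ ≤ i`» with `M − M₀ ≤ B₀`.  THEN there is a Kolyvagin prime `ℓ > n` (so `ℓ ∤ n`) killing `T_c` and
`T_n` with (I) for `c_next ℓ` against `𝒪·⟨T_n⟩` and bound `B₀ + N`.
[cite: McCallumLMS1991, Thm. 5.4 (proof, (21)–(23)), Prop. 4.7, Lemma 5.3, Prop. 3.1] -/
theorem coupledStep {p : ℕ} {M M₀ : ℕ} {Kol : ℕ → Prop}
    {pl : ℕ → Pl} {A : ℕ → AddSubgroup V} {A' : ℕ → AddSubgroup V'} {Sel' : AddSubgroup V'}
    {Loc' : Pl → AddSubgroup V'} (mem_sel'_iff : ∀ s, s ∈ Sel' ↔ ∀ v, s ∈ Loc' v)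
    (w : V →+ V) (w' : V' →+ V') (hwSel' : ∀ s ∈ Sel', w' s ∈ Sel') (P' : Sel' →+ Sel' →+ R)
    {n : ℕ} (hn : KolSupp Kol n) (ccur : V) (cnext : ℕ → V')
    (flip : ∀ ℓ, Kol ℓ → ¬ ℓ ∣ n → ∀ a : ℕ,
      ((p : ℤ) ^ a) • cnext ℓ ∈ Loc' (pl ℓ) ↔ ((p : ℤ) ^ a) • ccur ∈ A ℓ)
    (hCTV : ∀ ℓ, Kol ℓ → ¬ ℓ ∣ n → ∀ (j N a b : ℕ) (t : V') (ht : t ∈ Sel')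
      (hz : ((p : ℤ) ^ j) • cnext ℓ ∈ Sel'), ((p : ℤ) ^ N) • t = 0 →
      (∀ q ∈ n.primeFactors, t ∈ A' q) → M - M₀ ≤ j → N + M₀ ≤ M → N ≤ j → a + b + 1 = N →
      ((p : ℤ) ^ (a + (j - N))) • ccur ∉ A ℓ → ((p : ℤ) ^ b) • t ∉ A' ℓ → P' ⟨_, hz⟩ ⟨t, ht⟩ ≠ 0)
    (Tc : Finset V) (Tn : Finset V') (s : V')
    (hCeb : ∀ b : ℕ, ∃ ℓ, b < ℓ ∧ Kol ℓ ∧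
      (∀ g ∈ AddSubgroup.closure (insert ccur (insert (w ccur) ((Tc : Set V) ∪ w '' (Tc : Set V)))),
        g ∈ A ℓ ↔ g ∈ AddSubgroup.closure ((Tc : Set V) ∪ w '' (Tc : Set V))) ∧
      (∀ g ∈ AddSubgroup.closure (insert s (insert (w' s) ((Tn : Set V') ∪ w' '' (Tn : Set V')))),
        g ∈ A' ℓ ↔ g ∈ AddSubgroup.closure ((Tn : Set V') ∪ w' '' (Tn : Set V'))))
    (hTn : (Tn : Set V') ⊆ Sel') (hs : s ∈ Sel') {N : ℕ} (hN : ((p : ℤ) ^ N) • s = 0)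
    (hN' : N ≠ 0 → ((p : ℤ) ^ (N - 1)) • s ≠ 0) (hroom : N + M₀ ≤ M)
    (hsA : ∀ q ∈ n.primeFactors, s ∈ A' q)
    (hiso : ∀ t, ∀ ht : t ∈ (Tn : Set V'),
      P' ⟨t, hTn ht⟩ ⟨s, hs⟩ = 0 ∧ P' ⟨w' t, hwSel' _ (hTn ht)⟩ ⟨s, hs⟩ = 0)
    (hflag : ∀ a : ℤ, a • s ∈ AddSubgroup.closure ((Tn : Set V') ∪ w' '' (Tn : Set V')) → a • s = 0)
    {B₀ : ℕ} (hB₀ : M - M₀ ≤ B₀)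
    (hI : ∀ i : ℕ, ((p : ℤ) ^ i) • ccur ∈ AddSubgroup.closure ((Tc : Set V) ∪ w '' (Tc : Set V)) →
      B₀ ≤ i) :
    ∃ ℓ, n < ℓ ∧ Kol ℓ ∧ ¬ ℓ ∣ n ∧ (∀ t ∈ Tc, t ∈ A ℓ) ∧ (∀ t ∈ Tn, t ∈ A' ℓ) ∧
      ∀ i : ℕ, ((p : ℤ) ^ i) • cnext ℓ ∈ AddSubgroup.closure ((Tn : Set V') ∪ w' '' (Tn : Set V')) →
        B₀ + N ≤ i := by
  -- ### the Kolyvagin prime `ℓ = ℓ_{k+1}` (McCallum (21)–(23))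
  obtain ⟨ℓ, hℓn, hℓ, hkerc, hkern⟩ := hCeb n
  have hndvd : ¬ ℓ ∣ n := not_dvd_of_lt hn.1.ne_zero hℓn
  -- membership in the two spans `𝒪·⟨c_cur, T_c⟩`, `𝒪·⟨s, T_n⟩`
  have hGc : ∀ i : ℕ, ((p : ℤ) ^ i) • ccur ∈
      AddSubgroup.closure (insert ccur (insert (w ccur) ((Tc : Set V) ∪ w '' (Tc : Set V)))) :=
    fun i ↦ AddSubgroup.zsmul_mem _ (AddSubgroup.subset_closure (Set.mem_insert _ _)) _
  have hGs : ∀ i : ℕ, ((p : ℤ) ^ i) • s ∈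
      AddSubgroup.closure (insert s (insert (w' s) ((Tn : Set V') ∪ w' '' (Tn : Set V')))) :=
    fun i ↦ AddSubgroup.zsmul_mem _ (AddSubgroup.subset_closure (Set.mem_insert _ _)) _
  have hGTc : ∀ t ∈ (Tc : Set V),
      t ∈ AddSubgroup.closure (insert ccur (insert (w ccur) ((Tc : Set V) ∪ w '' (Tc : Set V)))) :=
    fun t ht ↦ AddSubgroup.subset_closure
      (Set.mem_insert_of_mem _ (Set.mem_insert_of_mem _ (Set.mem_union_left _ ht)))
  have hGTn : ∀ t ∈ (Tn : Set V'),
      t ∈ AddSubgroup.closure (insert s (insert (w' s) ((Tn : Set V') ∪ w' '' (Tn : Set V')))) :=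
    fun t ht ↦ AddSubgroup.subset_closure
      (Set.mem_insert_of_mem _ (Set.mem_insert_of_mem _ (Set.mem_union_left _ ht)))
  -- Fact B: `p^{i'} c_cur ∈ A ℓ ⟹ B₀ ≤ i'` (from (I) at `k` through the kernel clause)
  have hB : ∀ i' : ℕ, ((p : ℤ) ^ i') • ccur ∈ A ℓ → B₀ ≤ i' := fun i' hi' ↦
    hI i' ((hkerc _ (hGc i')).mp hi')
  refine ⟨ℓ, hℓn, hℓ, hndvd, fun t ht ↦ ?_, fun t ht ↦ ?_, fun i hi ↦ ?_⟩
  · -- (23) on the current curve: the later lifts vanish at `λ`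
    exact (hkerc t (hGTc t ht)).mpr (AddSubgroup.subset_closure (Set.mem_union_left _ ht))
  · -- (23) on the next curve
    exact (hkern t (hGTn t ht)).mpr (AddSubgroup.subset_closure (Set.mem_union_left _ ht))
  · -- ### the invariant (I) at `k + 1`
    have hSel : ((p : ℤ) ^ i) • cnext ℓ ∈ Sel' := closure_union_image_le w' hwSel' hTn hi
    have hAℓ : ((p : ℤ) ^ i) • ccur ∈ A ℓ :=
      (flip ℓ hℓ hndvd i).mp ((mem_sel'_iff _).mp hSel (pl ℓ))
    have hB0 := hB i hAℓ
    by_cases hN0 : N = 0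
    · rw [hN0]
      omega
    by_contra hlt
    push Not at hlt
    have hNi : N ≤ i := by omega
    -- (21): `p^{i - N} c_cur` does not vanish at `λ`
    have hnot : ((p : ℤ) ^ (0 + (i - N))) • ccur ∉ A ℓ := by
      intro h
      rw [zero_add] at h
      have := hB _ h
      omega
    -- (22): `s` has full order at `λ`
    have hsfull : ((p : ℤ) ^ (N - 1)) • s ∉ A' ℓ := by
      intro h
      have hT' := (hkern _ (hGs _)).mp h
      exact hN' hN0 (hflag _ hT')
    have hne := hCTV ℓ hℓ hndvd i N 0 (N - 1) s hs hSel hN hsA (le_trans hB₀ hB0) hroom hNi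
      (by omega) hnot hsfull
    -- isotropy of `𝒪·⟨T_n⟩ ∋ p^i c_next(ℓ)` against `s`
    refine hne (pairing_eq_zero_of_mem_closure P' ?_ hs (fun u hu ↦ ?_) hi hSel)
    · refine Set.union_subset hTn ?_
      rintro _ ⟨u, hu, rfl⟩
      exact hwSel' u (hTn hu)
    · rcases hu with hu | ⟨u', hu', rfl⟩
      · exact (hiso u hu).1
      · exact (hiso u' hu').2

end Step

end Summit.BirchSwinnertonDyer.BirchSwinnertonDyer.Theorems.SylvesterTwoCoupledTelescope
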